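import Summits.AtomisticToContinuum.HydrodynamicLimit.Theorems.LambertianContactSwapLambertianEulerEquilibriumCountStationarity
import Summits.AtomisticToContinuum.HydrodynamicLimit.Theorems.LambertianContactSwapLambertianEulerKorolyuk
import Summits.AtomisticToContinuum.HydrodynamicLimit.Theorems.LambertianContactSwapLambertianEulerFirstCollision
import Summits.AtomisticToContinuum.HydrodynamicLimit.Theorems.LambertianContactSwapLambertianEulerPairShellVel
import Summits.AtomisticToContinuum.HydrodynamicLimit.Theorems.LambertianContactSwapLambertianEulerSimpleCollisions
import Summits.AtomisticToContinuum.HydrodynamicLimit.Theorems.LambertianContactSwapLambertianEulerRestartInLaw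
import Summits.AtomisticToContinuum.HydrodynamicLimit.Theorems.UGibbsSRBRigidityTemperedCollisionsRung0
import Literature.MathematicalPhysics.KineticTheory.HardSphereEuler
import Mathlib.Analysis.SpecificLimits.Basic
import HarnessLib

/-!
# The `N`-uniform equilibrium collision rate of the Lambertian gas
# (`LambertianContactSwap.LambertianEuler`, stmt-AtomisticToContinuum-11854, line `Sketch`;
# stub `equilibriumCollisionRate_le`, assembly of the sub-goals E1–E5 of lead c9)

Support file (`--supports stmt-AtomisticToContinuum-11854`).  For `N + 1` hard spheres of diameter
`ε = ε_N = hsDiameter σ N = σ (N+1)^{-1/3}` on `𝕋³` (`0 < σ < 1/2`, `v₁ σ³ ≤ 1/2`) write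
`K_t (z, ξs) = lambertCount` for the number of Lambertian collisions in `[0, t]` of the trajectory from
`z` driven by the i.i.d. Gaussian redraws `ξs ∼ γ^ℕ = lambertNoise`, and `μ := G_N ⊗ γ^ℕ` for the
equilibrium law `G_N = localGibbsLaw σ b w ϑ N Φ` with CONSTANT profiles `b, ϑ > 0`, `w`.  Then there is
`C = C(w, ϑ) > 0` such that for all `σ, N, Φ` as above and `s, h ≥ 0`

  `E_μ [K_{s+h} − K_s] ≤ C σ² h (N+1)^{4/3}`:

the mean number of collisions in a window of length `h` is `O(h (N+1) · (N+1)^{1/3})`, i.e. each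
particle suffers `O((N+1)^{1/3}) = O(σ/ε_N)` collisions per unit time, UNIFORMLY in `N` (the
mean-free-path scaling at fixed reduced density `σ`).

## Proof (Campbell's bound via Korolyuk's theorem)

* Layer cake for `ℕ`-valued variables (`lintegral_natCast_eq_tsum`) and stationarity of the window
  increments at equilibrium (E1, `…EquilibriumCountStationarity.lambertCount_increment_law`):
  `E_μ[K_{s+h} − K_s] = Σ_k μ{k+1+K_s ≤ K_{s+h}} = Σ_k μ{k+1 ≤ K_h} = E_μ[K_h]`.
* Korolyuk / Fatou (E2, `…Korolyuk.lintegral_lambertCount_le_liminf`; its hypotheses — simple,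
  non-accumulating instants a.s. — are E5 `…SimpleCollisions.ae_freeExitTime_lambertStateAfter_pos` and
  `…RestartInLaw.ae_nonAccumulation_of_absolutelyContinuous`, as `G_N ≪ liouville`):
  `E_μ[K_h] ≤ liminf_n Σ_{j ≤ n} μ{1 + K_{jh'} ≤ K_{(j+1)h'}}`, `h' = h/(n+1)`.
* By E1 again each summand is `μ{1 ≤ K_{h'}}`, which by the first-collision inclusion (E3,
  `…FirstCollision.measure_lambertCount_pos_le`) and the static pair shell of velocity width (E4,
  `…PairShellVel.localGibbsLaw_pairShellVel_le`) is `≤ (N+1)² (C₁ ε² h' + C₂ h'²)`; hence the `n`-th sum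
  is `≤ (N+1)² (C₁ ε² h + C₂ h²/(n+1)) → (N+1)² C₁ ε² h = C₁ σ² h (N+1)^{4/3}` (the scaling identity
  `…UGibbsSRBRigidityTemperedCollisionsRung0.succ_sq_mul_hsDiameter_sq`).

References: Daley–Vere-Jones, *An Introduction to the Theory of Point Processes* I, §3.3 (Korolyuk,
Khinchin); Cercignani–Illner–Pulvirenti 1994, §2.2 (collision cylinders).  All statements [folklore]
given the landed sub-goals.
-/

noncomputable section

namespace Summit.AtomisticToContinuum.HydrodynamicLimit.Theorems.LambertianContactSwapLambertianEulerEquilibriumCollisionRate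

open scoped BigOperators Topology ENNReal InnerProductSpace
open MeasureTheory ProbabilityTheory Filter Set InformationTheory
open Literature.MathematicalPhysics.KineticTheory
open Literature.Analysis.FluidPDE Literature.Analysis.FluidPDE.Alexander
open Summit.AtomisticToContinuum.HydrodynamicLimit.Theorems.LambertianContactSwapLambertianEulerEquilibriumCountStationarity
open Summit.AtomisticToContinuum.HydrodynamicLimit.Theorems.LambertianContactSwapLambertianEulerKorolyuk
open Summit.AtomisticToContinuum.HydrodynamicLimit.Theorems.LambertianContactSwapLambertianEulerFirstCollision
open Summit.AtomisticToContinuum.HydrodynamicLimit.Theorems.LambertianContactSwapLambertianEulerPairShellVel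
open Summit.AtomisticToContinuum.HydrodynamicLimit.Theorems.LambertianContactSwapLambertianEulerSimpleCollisions
open Summit.AtomisticToContinuum.HydrodynamicLimit.Theorems.LambertianContactSwapLambertianEulerRestartInLaw

/-! ## Two elementary tools: layer cake on `ℕ`, casts -/

/-- **Layer cake for `ℕ`-valued functions**: `∫⁻ f dμ = Σ_{k ≥ 0} μ {k + 1 ≤ f}` for a measurable
`f : α → ℕ` (pointwise `n = Σ_k 1{k + 1 ≤ n}`, then `lintegral_tsum`). [folklore] -/
theorem lintegral_natCast_eq_tsum {α : Type*} [MeasurableSpace α] (μ : Measure α) {f : α → ℕ}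
    (hf : Measurable f) : ∫⁻ x, (f x : ℝ≥0∞) ∂μ = ∑' k : ℕ, μ {x | k + 1 ≤ f x} := by
  have hmeas : ∀ k : ℕ, MeasurableSet {x | k + 1 ≤ f x} := fun k =>
    measurableSet_le measurable_const hf
  have hpt : ∀ x, (f x : ℝ≥0∞) = ∑' k : ℕ, {y | k + 1 ≤ f y}.indicator (1 : α → ℝ≥0∞) x := by
    intro x
    rw [tsum_eq_sum (s := Finset.range (f x)) fun k hk => ?_]
    · calc (f x : ℝ≥0∞) = ∑ _k ∈ Finset.range (f x), (1 : ℝ≥0∞) := by simp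
        _ = _ := Finset.sum_congr rfl fun k hk => ?_
      have hk' : x ∈ {y | k + 1 ≤ f y} := by
        have := Finset.mem_range.1 hk
        show k + 1 ≤ f x
        omega
      rw [Set.indicator_of_mem hk', Pi.one_apply]
    · have hk' : x ∉ {y | k + 1 ≤ f y} := by
        have := Finset.mem_range.not.1 hk
        show ¬(k + 1 ≤ f x)
        omega
      rw [Set.indicator_of_notMem hk']
  calc ∫⁻ x, (f x : ℝ≥0∞) ∂μ = ∫⁻ x, ∑' k : ℕ, {y | k + 1 ≤ f y}.indicator (1 : α → ℝ≥0∞) x ∂μ :=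
        lintegral_congr fun x => hpt x
    _ = ∑' k : ℕ, ∫⁻ x, {y | k + 1 ≤ f y}.indicator (1 : α → ℝ≥0∞) x ∂μ :=
        lintegral_tsum fun k => (measurable_one.indicator (hmeas k)).aemeasurable
    _ = ∑' k : ℕ, μ {x | k + 1 ≤ f x} := tsum_congr fun k => lintegral_indicator_one (hmeas k)

/-- Casts: `(m : ℝ≥0∞) * ofReal x = ofReal (m x)` for `m : ℕ`. [folklore] -/
theorem natCast_mul_ofReal (m : ℕ) (x : ℝ) :
    (m : ℝ≥0∞) * ENNReal.ofReal x = ENNReal.ofReal ((m : ℝ) * x) := by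
  rw [ENNReal.ofReal_mul (Nat.cast_nonneg _), ENNReal.ofReal_natCast]

/-! ## The equilibrium collision rate -/

/-- **ECR. The `N`-uniform mean collision rate of the Lambertian gas at equilibrium** (registered stub
`equilibriumCollisionRate_le` of stmt-11854, line `Sketch`).  For constant profiles `b, ϑ > 0`, `w` there
is `C > 0` such that for `0 < σ < 1/2` with `v₁ σ³ ≤ 1/2`, all `N`, `Φ`, `s, h ≥ 0`:
`∫⁻ (K_{s+h} − K_s) d(G_N ⊗ γ^ℕ) ≤ C σ² h (N+1)^{4/3}` — layer cake + stationarity of increments (E1),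
Korolyuk/Fatou (E2, with simplicity E5 and non-accumulation), first-collision inclusion (E3) and the
static pair shell of velocity width (E4), then `(N+1)² ε_N² = σ² (N+1)^{4/3}`
(`succ_sq_mul_hsDiameter_sq`). [folklore] -/
theorem equilibriumCollisionRate_le :
    ∀ (b ϑ : ℝ) (w : V3), 0 < b → 0 < ϑ → ∃ C : ℝ, 0 < C ∧ ∀ σ : ℝ, 0 < σ → σ < 2⁻¹ → v₁ * σ ^ 3 ≤ 1 / 2 →
      ∀ (N : ℕ) (Φ : HardSphereFlow (Torus.geometry (Fin 3)) (hsDiameter σ N) (N + 1)) (s h : ℝ), 0 ≤ s → 0 ≤ h →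
        ∫⁻ p, ((lambertCount (Torus.geometry (Fin 3)) (hsDiameter σ N) p.2 p.1 (s + h) -
            lambertCount (Torus.geometry (Fin 3)) (hsDiameter σ N) p.2 p.1 s : ℕ) : ℝ≥0∞)
          ∂((localGibbsLaw σ (fun _ => b) (fun _ => w) (fun _ => ϑ) N Φ).prod (lambertNoise (Fin 3))) ≤
          ENNReal.ofReal (C * σ ^ 2 * h * ((N : ℝ) + 1) ^ (4 / 3 : ℝ)) := by
  intro b ϑ w hb hϑ
  obtain ⟨C₁, hC₁, H4⟩ := localGibbsLaw_pairShellVel_le b ϑ w hb hϑ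
  refine ⟨C₁, hC₁, ?_⟩
  intro σ hσ hσ' hv N Φ s h hs hh
  obtain ⟨C₂, hC₂, H4'⟩ := H4 σ hσ hσ' hv N Φ
  haveI := isProbabilityMeasure_localGibbsLaw_const hσ' N w hb hϑ Φ
  -- notation
  set G := localGibbsLaw σ (fun _ => b) (fun _ => w) (fun _ => ϑ) N Φ with hGdef
  set μ : Measure (Config (N + 1) (Fin 3) T3 × (ℕ → V3)) := G.prod (lambertNoise (Fin 3)) with hμ
  have hGac : G ≪ liouville (Torus.geometry (Fin 3)) (N + 1) (hsDiameter σ N) :=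
    localGibbsLaw_absolutelyContinuous σ _ _ _ N Φ
  have hreg : (Torus.geometry (Fin 3)).IsHardSphereRegular (hsDiameter σ N) :=
    Torus.isHardSphereRegular_geometry ((hsDiameter_le hσ.le N).trans_lt hσ')
  have hKm : ∀ t : ℝ, Measurable fun p : Config (N + 1) (Fin 3) T3 × (ℕ → V3) =>
      lambertCount (Torus.geometry (Fin 3)) (hsDiameter σ N) p.2 p.1 t :=
    fun t => measurable_lambertCount hreg Torus.isMeasurable_geometry t
  -- the case `h = 0`
  rcases hh.eq_or_lt with rfl | hhpos
  · simp
  -- Step 1: `E[K_{s+h} − K_s] = E[K_h]` (layer cake + stationarity of the increments)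
  have h1 : ∫⁻ p, ((lambertCount (Torus.geometry (Fin 3)) (hsDiameter σ N) p.2 p.1 (s + h) -
        lambertCount (Torus.geometry (Fin 3)) (hsDiameter σ N) p.2 p.1 s : ℕ) : ℝ≥0∞) ∂μ =
      ∫⁻ p, (lambertCount (Torus.geometry (Fin 3)) (hsDiameter σ N) p.2 p.1 h : ℝ≥0∞) ∂μ := by
    have hsub : Measurable fun p : Config (N + 1) (Fin 3) T3 × (ℕ → V3) =>
        lambertCount (Torus.geometry (Fin 3)) (hsDiameter σ N) p.2 p.1 (s + h) -
          lambertCount (Torus.geometry (Fin 3)) (hsDiameter σ N) p.2 p.1 s := (hKm (s + h)).sub (hKm s)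
    rw [lintegral_natCast_eq_tsum μ hsub, lintegral_natCast_eq_tsum μ (hKm h)]
    refine tsum_congr fun k => ?_
    rw [hμ, ← lambertCount_increment_law hσ hσ' N b ϑ w hb hϑ Φ s h hs hh (k + 1)]
    congr 1
    ext p
    simp only [Set.mem_setOf_eq]
    omega
  -- Step 2: the one-interval bound `μ {1 ≤ K_δ} ≤ (N+1)² (C₁ ε² δ + C₂ δ²)` (E3 + E4)
  have h2 : ∀ δ : ℝ, 0 ≤ δ →
      μ {p | 1 ≤ lambertCount (Torus.geometry (Fin 3)) (hsDiameter σ N) p.2 p.1 δ} ≤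
        ENNReal.ofReal (((N : ℝ) + 1) ^ 2 * (C₁ * hsDiameter σ N ^ 2 * δ + C₂ * δ ^ 2)) := by
    intro δ hδ
    have hpair : ∀ i j : Fin (N + 1),
        G {z | i ≠ j ∧ hsDiameter σ N ≤ ‖(Torus.geometry (Fin 3)).sepVec (z i).1 (z j).1‖ ∧
          ‖(Torus.geometry (Fin 3)).sepVec (z i).1 (z j).1‖ ≤ hsDiameter σ N + δ * ‖(z i).2 - (z j).2‖} ≤
          ENNReal.ofReal (C₁ * hsDiameter σ N ^ 2 * δ + C₂ * δ ^ 2) := by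
      intro i j
      by_cases hij : i = j
      · exact le_of_eq_of_le (measure_mono_null (fun z hz => absurd hij hz.1) measure_empty) zero_le
      · exact (measure_mono fun z hz => hz.2).trans (H4' i j hij δ hδ)
    calc μ {p | 1 ≤ lambertCount (Torus.geometry (Fin 3)) (hsDiameter σ N) p.2 p.1 δ}
        ≤ ∑ i : Fin (N + 1), ∑ j : Fin (N + 1),
            G {z | i ≠ j ∧ hsDiameter σ N ≤ ‖(Torus.geometry (Fin 3)).sepVec (z i).1 (z j).1‖ ∧
              ‖(Torus.geometry (Fin 3)).sepVec (z i).1 (z j).1‖ ≤ hsDiameter σ N + δ * ‖(z i).2 - (z j).2‖} :=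
          measure_lambertCount_pos_le hσ hσ' N G hGac δ hδ
      _ ≤ ∑ _i : Fin (N + 1), ∑ _j : Fin (N + 1), ENNReal.ofReal (C₁ * hsDiameter σ N ^ 2 * δ + C₂ * δ ^ 2) :=
          Finset.sum_le_sum fun i _ => Finset.sum_le_sum fun j _ => hpair i j
      _ = ENNReal.ofReal (((N : ℝ) + 1) ^ 2 * (C₁ * hsDiameter σ N ^ 2 * δ + C₂ * δ ^ 2)) := by
          simp only [Finset.sum_const, Finset.card_univ, Fintype.card_fin, nsmul_eq_mul, natCast_mul_ofReal]
          congr 1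
          push_cast
          ring
  -- Step 3: the `n`-th Korolyuk sum is `≤ (N+1)² (C₁ ε² h + C₂ h² / (n+1))` (E1 termwise + Step 2)
  set bnd : ℕ → ℝ≥0∞ := fun n => ENNReal.ofReal (((N : ℝ) + 1) ^ 2 *
    (C₁ * hsDiameter σ N ^ 2 * h + C₂ * h ^ 2 * (1 / ((n : ℝ) + 1)))) with hbnd
  have h3 : ∀ n : ℕ, (∑ j ∈ Finset.range (n + 1),
      μ {p | 1 + lambertCount (Torus.geometry (Fin 3)) (hsDiameter σ N) p.2 p.1 ((j : ℝ) * (h / ((n : ℝ) + 1))) ≤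
        lambertCount (Torus.geometry (Fin 3)) (hsDiameter σ N) p.2 p.1 (((j : ℝ) + 1) * (h / ((n : ℝ) + 1)))}) ≤
      bnd n := by
    intro n
    have hn : (0 : ℝ) < (n : ℝ) + 1 := by positivity
    have hδ : 0 ≤ h / ((n : ℝ) + 1) := div_nonneg hh hn.le
    have hterm : ∀ j ∈ Finset.range (n + 1),
        μ {p | 1 + lambertCount (Torus.geometry (Fin 3)) (hsDiameter σ N) p.2 p.1 ((j : ℝ) * (h / ((n : ℝ) + 1))) ≤
          lambertCount (Torus.geometry (Fin 3)) (hsDiameter σ N) p.2 p.1 (((j : ℝ) + 1) * (h / ((n : ℝ) + 1)))} ≤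
        ENNReal.ofReal (((N : ℝ) + 1) ^ 2 *
          (C₁ * hsDiameter σ N ^ 2 * (h / ((n : ℝ) + 1)) + C₂ * (h / ((n : ℝ) + 1)) ^ 2)) := by
      intro j _
      have hj : 0 ≤ (j : ℝ) * (h / ((n : ℝ) + 1)) := mul_nonneg (Nat.cast_nonneg _) hδ
      rw [show ((j : ℝ) + 1) * (h / ((n : ℝ) + 1)) = (j : ℝ) * (h / ((n : ℝ) + 1)) + h / ((n : ℝ) + 1) by ring,
        hμ, lambertCount_increment_law hσ hσ' N b ϑ w hb hϑ Φ _ _ hj hδ 1]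
      exact h2 _ hδ
    calc _ ≤ ∑ _j ∈ Finset.range (n + 1), ENNReal.ofReal (((N : ℝ) + 1) ^ 2 *
          (C₁ * hsDiameter σ N ^ 2 * (h / ((n : ℝ) + 1)) + C₂ * (h / ((n : ℝ) + 1)) ^ 2)) :=
          Finset.sum_le_sum hterm
      _ = bnd n := by
          rw [Finset.sum_const, Finset.card_range, nsmul_eq_mul, natCast_mul_ofReal, hbnd]
          congr 1
          push_cast
          field_simp
  -- Step 4: the bound converges to `(N+1)² C₁ ε² h`
  have h4 : Tendsto bnd atTop (𝓝 (ENNReal.ofReal (((N : ℝ) + 1) ^ 2 *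
      (C₁ * hsDiameter σ N ^ 2 * h + C₂ * h ^ 2 * 0)))) := by
    refine ENNReal.tendsto_ofReal (Tendsto.const_mul _ (tendsto_const_nhds.add ?_))
    exact tendsto_one_div_add_atTop_nhds_zero_nat.const_mul _
  -- Step 5: Korolyuk (E2) with simplicity (E5) and non-accumulation, and the assembly
  calc ∫⁻ p, ((lambertCount (Torus.geometry (Fin 3)) (hsDiameter σ N) p.2 p.1 (s + h) -
          lambertCount (Torus.geometry (Fin 3)) (hsDiameter σ N) p.2 p.1 s : ℕ) : ℝ≥0∞) ∂μ
      = ∫⁻ p, (lambertCount (Torus.geometry (Fin 3)) (hsDiameter σ N) p.2 p.1 h : ℝ≥0∞) ∂μ := h1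
    _ ≤ liminf (fun n : ℕ => ∑ j ∈ Finset.range (n + 1),
          μ {p | 1 + lambertCount (Torus.geometry (Fin 3)) (hsDiameter σ N) p.2 p.1 ((j : ℝ) * (h / ((n : ℝ) + 1))) ≤
            lambertCount (Torus.geometry (Fin 3)) (hsDiameter σ N) p.2 p.1 (((j : ℝ) + 1) * (h / ((n : ℝ) + 1)))})
          atTop :=
        lintegral_lambertCount_le_liminf hσ hσ' N μ
          (ae_freeExitTime_lambertStateAfter_pos hσ hσ' N G hGac)
          (ae_nonAccumulation_of_absolutelyContinuous hσ hσ' N G hGac) h hhpos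
    _ ≤ liminf bnd atTop := liminf_le_liminf (Eventually.of_forall h3)
    _ = ENNReal.ofReal (((N : ℝ) + 1) ^ 2 * (C₁ * hsDiameter σ N ^ 2 * h + C₂ * h ^ 2 * 0)) := h4.liminf_eq
    _ = ENNReal.ofReal (C₁ * σ ^ 2 * h * ((N : ℝ) + 1) ^ (4 / 3 : ℝ)) := by
        rw [mul_zero, add_zero, show ((N : ℝ) + 1) ^ 2 * (C₁ * hsDiameter σ N ^ 2 * h) =
          C₁ * h * (((N : ℝ) + 1) ^ 2 * hsDiameter σ N ^ 2) by ring, succ_sq_mul_hsDiameter_sq]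
        ring_nf

end Summit.AtomisticToContinuum.HydrodynamicLimit.Theorems.LambertianContactSwapLambertianEulerEquilibriumCollisionRate

end
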